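import Summits.BirchSwinnertonDyer.BirchSwinnertonDyer.Theorems.TwoAdicConverseBDPSelmerLowerDivisibilityAtTwoEisensteinDevissageResidual
import HarnessLib

/-!
# Crux O2 `BDPSelmerLowerDivisibilityAtTwo` (stmt-BirchSwinnertonDyer-24728), v7 stub P5 `stub_eisensteinDevissage`:
# the KUMMER STEP `E[p^∞] ⇝ E[p]` for Greenberg–Vatsal's datum Selmer group of Castella's data (inertia above `𝔭`)

Cell `bsd-2adic`, seat `bsd-2adic-conv-1` GEN 40 (`--supports stmt-BirchSwinnertonDyer-24728`, helper). THEOREMS ONLY: no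
definition, no named fact, no instance, no `sorry`; nothing about any `L`-function; O2 / 19556 / 19218 OPEN; BSD is proved for
no curve by this file.

For an elliptic curve `E = W/K` over a number field, ANY prime `p`, ANY `ℤ_p`-extension `κ` (`H = ker κ = Gal(K̄/K_∞)`), a place
`𝔭 ∋ p` finitely decomposed in `K_∞` (`D_𝔭 ⊄ ker κ`) and a set `S₀` containing every bad place prime to `p`:

* §1 `inf_inertia_smul_geomPrimaryTorsion_eq` — (U) for `E[p^∞]`: at a good `w ∤ p` the group `H ⊓ I_w` acts trivially on
  `E[p^∞]` (Silverman VII.4.1 (a), tree `smul_eq_of_mem_inertia_of_nsmul_eq_zero`, at the prime `𝔓₀ = adicCompletionPrime K w`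
  of the chosen embedding, `inertia_adicCompletionPrime_eq_map_absInertia`); `inf_inertia_smul_geomTorsion_eq` — the same
  for `E[n]`, `w ∤ n`;
* §2 **`finite_pTorsion_datumSelmer_bdpData_of_finite_residual`** — if the RESIDUAL group
  `S^{S₀}_{E[p]}(K_∞) = datumSelmer H E[p] p (bdpData E[p] p 𝔭) S₀` is finite then so is the `p`-torsion of
  `S^{S₀}_{E[p^∞]}(K_∞) = datumSelmer H E[p^∞] p (bdpData E[p^∞] p 𝔭) S₀`: every `p`-torsion class is `ι y` along
  `ι = (E[p] ↪ E[p^∞])_*` (`exists_torsionToPrimaryH1Sub_eq`, `E(K̄)` divisible — `zsmul_geomPoints_surjective_holds`), and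
  `ι⁻¹ S(E[p^∞])` is finite by the residual dévissage `finite_preimage_datumSelmer_of_finite_ker` (brick 1): (U) by §1, and
  the kernel of `ι` on `H¹(H ⊓ I_𝔭, ·)` is finite (`finite_ker_torsionToPrimaryH1Sub`, `E(K_{∞,𝔭}^{I})[p^∞] ⊗ ℤ/p`).
  (The Lim–Sujatha §3 / Greenberg §3 mechanism; the tree's `finite_selmerAc_pTorsion_of_finite_residualSelmer` is the same
  for Castella's strict group.)

References: [LimSujatha2018] §3 (proof of Prop. 3.2); [GreenbergLNM1716] §3 Lemmas 3.1–3.3; [GreenbergVatsal2000] §2 pp. 16–17;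
[SilvermanAEC2009] Prop. VII.4.1 (a); [NeukirchANT1999] II (9.6).
-/

set_option autoImplicit false
-- D-0017: the summit and its sub-problem share the name `BirchSwinnertonDyer`.
set_option linter.dupNamespace false

noncomputable section

open scoped Classical

namespace Summit.BirchSwinnertonDyer.BirchSwinnertonDyer.Theorems.TwoAdicBDPEisensteinDevissage

open NumberField IsDedekindDomain Field WeierstrassCurve
open Literature.NumberTheory.EllipticCurves Literature.NumberTheory.EllipticCurves.GreenbergSelmer
  Literature.NumberTheory.EllipticCurves.GreenbergVatsal2000 Literature.NumberTheory.GaloisRepresentations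
  Summit.BirchSwinnertonDyer.BirchSwinnertonDyer.Theorems.CumulativeHeegnerInclusionAtThreeStubB1DevissageNamed

variable {K : Type} [Field K] [NumberField K] (W : WeierstrassCurve K) [W.IsElliptic]

/-! ### §1 (U): the inertia groups at the good places act trivially on `E[p^∞]` and on `E[n]` -/

/-- **At a good place `w ∤ p`, `H ⊓ I_w` acts trivially on `E[p^∞]`** (`I_w` the inertia group of the prime `𝔓₀` above `w`
cut out by the chosen embedding): every `m ∈ E[p^∞]` is killed by some `p^k`, prime to `w`, and Silverman VII.4.1 (a) applies.
[cite: SilvermanAEC2009, Prop. VII.4.1(a)] [cite: NeukirchANT1999, Ch. II §9 Prop. (9.6)] -/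
theorem inf_inertia_smul_geomPrimaryTorsion_eq (p : ℕ) (H : Subgroup (absoluteGaloisGroup K))
    {w : HeightOneSpectrum (𝓞 K)} (hw : W.HasGoodReductionAt w) (hpw : ((p : ℕ) : 𝓞 K) ∉ w.asIdeal)
    (τ : ↥(H ⊓ inertia w)) (m : W.geomPrimaryTorsion p) : τ • m = m := by
  have hτI : (τ : absoluteGaloisGroup K) ∈ inertia w := (Subgroup.mem_inf.mp τ.2).2
  have hI𝔓 : (τ : absoluteGaloisGroup K) ∈ (adicCompletionPrime K w).inertia (absoluteGaloisGroup K) := by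
    rw [inertia_adicCompletionPrime_eq_map_absInertia]; exact hτI
  obtain ⟨k, hk⟩ : ∃ k : ℕ, p ^ k • m = 0 := by
    obtain ⟨k, hk⟩ := m.2
    exact ⟨k, Subtype.ext (by rw [AddSubgroupClass.coe_nsmul]; exact hk)⟩
  change (τ : absoluteGaloisGroup K) • m = m
  apply Subtype.ext
  rw [primaryComponent.coe_smul]
  have hk' : (p ^ k : ℕ) • (m : W.geomPoints) = 0 := by
    have := congrArg (fun z : W.geomPrimaryTorsion p ↦ (z : W.geomPoints)) hk
    simpa only [AddSubmonoidClass.coe_nsmul, ZeroMemClass.coe_zero] using this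
  exact W.smul_eq_of_mem_inertia_of_nsmul_eq_zero hw (w.natCast_pow_not_mem hpw k)
    (adicCompletionPrime_mem_primesAbove K w) hI𝔓 hk'

/-- **At a good place `w ∤ n`, `H ⊓ I_w` acts trivially on `E[n]`** (Silverman VII.4.1 (a), tree
`smul_geomTorsion_eq_of_mem_inertia`). [cite: SilvermanAEC2009, Prop. VII.4.1(a)] -/
theorem inf_inertia_smul_geomTorsion_eq (n : ℕ) (H : Subgroup (absoluteGaloisGroup K))
    {w : HeightOneSpectrum (𝓞 K)} (hw : W.HasGoodReductionAt w) (hnw : ((n : ℕ) : 𝓞 K) ∉ w.asIdeal)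
    (τ : ↥(H ⊓ inertia w)) (P : W.geomTorsion (n : ℤ)) : τ • P = P := by
  have hτI : (τ : absoluteGaloisGroup K) ∈ inertia w := (Subgroup.mem_inf.mp τ.2).2
  have hI𝔓 : (τ : absoluteGaloisGroup K) ∈ (adicCompletionPrime K w).inertia (absoluteGaloisGroup K) := by
    rw [inertia_adicCompletionPrime_eq_map_absInertia]; exact hτI
  have hn : (((n : ℤ) : 𝓞 K)) ∉ w.asIdeal := by exact_mod_cast hnw
  exact W.smul_geomTorsion_eq_of_mem_inertia hw hn (adicCompletionPrime_mem_primesAbove K w) hI𝔓 P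

/-! ### §2 The Kummer step: `S^{S₀}_{E[p]}(K_∞)` finite ⟹ `S^{S₀}_{E[p^∞]}(K_∞)[p]` finite -/

variable {p : ℕ} [Fact p.Prime] (κ : ZpExtension K p)

/-- **`S^{S₀}_{E[p]}(K_∞)` finite ⟹ the `p`-torsion of `S^{S₀}_{E[p^∞]}(K_∞)` is finite** (Greenberg–Vatsal's datum
Selmer groups of Castella's data `bdpData · p 𝔭`: unramified at the finite `w ∉ S₀`, `w ∤ p`, Greenberg's inertia condition
above `𝔭`, nothing above the other primes over `p`), for `𝔭 ∋ p` finitely decomposed in `K_∞` and `S₀ ⊇` the bad places prime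
to `p`. Every `p`-torsion class is `ι y` (`exists_torsionToPrimaryH1Sub_eq`); `ι⁻¹ S(E[p^∞])` is finite by brick 1's
`finite_preimage_datumSelmer_of_finite_ker` — (U) by `inf_inertia_smul_geomPrimaryTorsion_eq`, the kernel of `ι` on
`H¹(H ⊓ I_𝔭, ·)` by `finite_ker_torsionToPrimaryH1Sub`.
[cite: LimSujatha2018, §3 (proof of Prop. 3.2)] [cite: GreenbergLNM1716, §3 (Lemmas 3.1–3.3)] [cite: GreenbergVatsal2000, §2 p. 17] -/
theorem finite_pTorsion_datumSelmer_bdpData_of_finite_residual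
    {𝔭 : HeightOneSpectrum (𝓞 K)} (h𝔭 : ((p : ℕ) : 𝓞 K) ∈ 𝔭.asIdeal)
    (h𝔭dec : ¬ (decomp 𝔭 ≤ κ.kerSubgroup)) {S₀ : Set (HeightOneSpectrum (𝓞 K))}
    (hS : ∀ w : HeightOneSpectrum (𝓞 K), w ∉ S₀ → ((p : ℕ) : 𝓞 K) ∉ w.asIdeal → W.HasGoodReductionAt w)
    (hfin : (datumSelmer κ.kerSubgroup (W.geomTorsion (p : ℤ)) p
        (Castella2018.AcSelmer.bdpData _ p 𝔭) S₀ :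
        Set (Literature.NumberTheory.EllipticCurves.subgroupH1 κ.kerSubgroup (W.geomTorsion (p : ℤ)))).Finite) :
    Set.Finite {c : W.subgroupH1 p κ.kerSubgroup |
      c ∈ datumSelmer κ.kerSubgroup (W.geomPrimaryTorsion p) p
        (Castella2018.AcSelmer.bdpData _ p 𝔭) S₀ ∧ p • c = 0} := by
  -- notation: `H`, the inclusion `j : E[p] ↪ E[p^∞]` and `ι = j_*` (definitionally `torsionToPrimaryH1Sub`)
  let H := κ.kerSubgroup
  let j : ↥(W.geomTorsion (p : ℤ)) →+ ↥(W.geomPrimaryTorsion p) :=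
    AddSubgroup.inclusion (geomTorsion_le_geomPrimaryTorsion W p)
  have hj' : ∀ (σ : absoluteGaloisGroup K) (a : W.geomTorsion (p : ℤ)), j (σ • a) = σ • j a := fun _ _ ↦ rfl
  have hι : W.torsionToPrimaryH1Sub p H = resH1Hom (ContinuousMonoidHom.id H) j (fun _ a ↦ hj' _ a) := rfl
  -- `Y = ι⁻¹ S(E[p^∞])` is finite (brick 1, §3)
  have hY : Set.Finite {x : Literature.NumberTheory.EllipticCurves.subgroupH1 H (W.geomTorsion (p : ℤ)) |
      resH1Hom (ContinuousMonoidHom.id H) j (fun _ a ↦ hj' _ a) x ∈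
        datumSelmer H (W.geomPrimaryTorsion p) p (Castella2018.AcSelmer.bdpData _ p 𝔭) S₀} := by
    refine finite_preimage_datumSelmer_of_finite_ker κ 𝔭 S₀ h𝔭 h𝔭dec j hj' (fun w hwS hwp ↦ ?_) ?_ hfin
    · -- (U) at the good `w ∉ S₀`
      exact resH1Hom_id_injective_of_smul_eq (G := ↥(H ⊓ inertia w)) j (fun _ a ↦ hj' _ a)
        (AddSubgroup.inclusion_injective _)
        (fun τ m ↦ inf_inertia_smul_geomPrimaryTorsion_eq W p H (hS w hwS hwp) hwp τ m)
    · -- the local Kummer kernel on `H ⊓ I_𝔭` is finite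
      refine (W.finite_ker_torsionToPrimaryH1Sub p (H := H ⊓ inertia 𝔭) W.zsmul_geomPoints_surjective_holds).subset ?_
      intro y hy
      exact hy
  -- every `p`-torsion Selmer class is `ι x`, `x ∈ Y`
  refine ((hY.image (W.torsionToPrimaryH1Sub p H)).subset ?_)
  rintro c ⟨hc, hpc⟩
  obtain ⟨x, hx⟩ := W.exists_torsionToPrimaryH1Sub_eq p W.zsmul_geomPoints_surjective_holds hpc
  refine ⟨x, ?_, hx⟩
  change resH1Hom (ContinuousMonoidHom.id H) j (fun _ a ↦ hj' _ a) x ∈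
    datumSelmer H (W.geomPrimaryTorsion p) p (Castella2018.AcSelmer.bdpData _ p 𝔭) S₀
  rw [← hι, hx]
  exact hc

end Summit.BirchSwinnertonDyer.BirchSwinnertonDyer.Theorems.TwoAdicBDPEisensteinDevissage

end
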